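import Summits.Langlands.Langlands.Theorems.TatePhantomLift
import Summits.Langlands.Langlands.Theses.PerfectLayerClifford
import Summits.Langlands.Langlands.Theses.MonomialConverse
import Summits.Langlands.Langlands.Theses.PrimeSwitchSplit

/-!
# `RegularShadowSplit` — lens-4 («minimal counterexample / extremal reduction») g32 node — THEOREMS TWIN (no bare `closes`; census G37)

«ON THE FINITE-TYPE CELL THE REGULAR REPRESENTATION SEES THROUGH THE `μ_f`-AMBIGUITY.»

TARGET (BY NAME) = FINTYPE = `Summit.Langlands.Langlands.Theses.PerfectLayerClifford.FiniteTypePerfectDescent` (tree text sha12 `3924d1b21172`) =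
ledger item stmt-Langlands-27356 (crux, rank 4, leaf INSTRUMENTABLE, OPEN) of route-Langlands-PerfectLayerClifford (rev 0): reciprocity for a
cuspidal L-algebraic `π` on `GL_n/K` of FINITE SATAKE-RATIO TYPE (a.e. `v`: all ratios of Satake parameters are roots of unity) ACROSS a Galois
layer `L/K` without cyclic sub-layer of prime degree, GIVEN a semisimple REDUCIBLE relative avatar `r : Γ_L → GL_n(ℚ̄_ℓ)` of `π`
(`charpoly r(Frob_w) = Sat(t_{π,v}^{f(w|v)})` a.e.).  The route's docstring calls it the Artin–Maass cell «from which no Galois representation can be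
built».  It is the ONE item of the lineage RootDecomp1 › CyclicLayerPeeling › GaloisHullLift › PerfectLayerClifford nobody has cut (EXT: g26/g28,
RIGID: g29/g30, RED°: g31).  This node is the MINIMAL-COUNTEREXAMPLE analysis of that cell: a counterexample `π` must survive (i) the twist
normalisation, (ii) Burnside, (iii) the regular-representation Rankin–Selberg identity — and (iii) leaves it no room once strong Artin holds for
the splitting group.  The lineage's nemesis — the `μ_f`-ambiguity «`π` is known on `L` only through `t^{f}`» that makes RIGID idea-needed — is
DISSOLVED on this cell, because a class function that only knows the ORDER of `Frob_v` is exactly what the regular representation integrates.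

## Mechanism (paper proof of `RegularShadowRigidity`, complete modulo the cited theorems; ≈ 1 page)

Let `π' := π ⊗ η⁻¹` (cuspidal, unitary: its Satake parameters are roots of unity a.e.) be of PURE GALOIS TYPE along a finite `M/K`
(w.l.o.g. Galois, group `Γ`; pass to the Galois closure): `t_{π',v}^{f_v} = (1,…,1)` for a.e. `v`, `f_v` = residue degree = order of `Frob_v` in `Γ`.
Assume strong Artin over `K` (a.e. form): every irreducible `A ∈ Irr(Γ)` has a cuspidal `π_A` on `GL_{dim A}/K` with `Sat(π_A,v) = sp A(Frob_v)` a.e.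
(`dim A = 1`: class field theory, tree `artinReciprocity_character_holds`).  For `v ∉ S` (finite) the local Rankin–Selberg factors satisfy
  `∏_{A ∈ Irr Γ} L_v(s, π' × π̃_A)^{dim A} = ∏ᵢ ∏_{ζ ∈ μ_{f_v}} (1 − tᵢ ζ̄ q_v^{-s})^{-|Γ|/f_v} = ∏ᵢ (1 − tᵢ^{f_v} q_v^{-f_v s})^{-|Γ|/f_v} = (1 − q_v^{-f_v s})^{-n|Γ|/f_v} = ∏_{u ∣ v} (1 − N(u)^{-s})^{-n}`,
because `⊕_A (dim A)·A = ℂ[Γ]` (regular representation: `Frob_v` has each `f_v`-th root of unity as eigenvalue with multiplicity `|Γ|/f_v`),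
`∏_{ζ ∈ μ_f}(1 − xζ) = 1 − x^f` (kernel-certified below: `regular_collapse`), and `tᵢ^{f_v} = 1`.  Hence
  `∏_{A} L^S(s, π' × π̃_A)^{dim A} = ζ_M^S(s)^n`  on `Re s > 1`, and by meromorphic continuation everywhere.
The right side has a pole of order exactly `n ≥ 1` at `s = 1` (Dedekind).  On the left, `L^S(s, π' × π̃_A)` is holomorphic and NON-ZERO at `s = 1`
unless `π_A ≅ π'`, where it has a simple pole (Jacquet–Shalika 1981 (I) Prop. 3.6/(3.7) and (II) Thm 4.8 classification; Shahidi 1981 Thm 5.2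
non-vanishing on `Re s = 1`; the finitely many omitted JPSS local factors are finite and non-zero at `s = 1` for unitary generic pairs).  Distinct
`A` give non-isomorphic `π_A` (Chebotarev + linear independence of characters), so the left order is `dim A₀` for the unique `A₀` with
`π_{A₀} ≅ π'` — which therefore EXISTS and has `dim A₀ = n`.  Then `ρ := ι⁻¹(A₀)^∨ ⊗ ψ_η` (the dual absorbs the inversion in `arithFrobPolyOfSatake ι q 1`, the
common convention of `SatakeFrobCompatibleAt` and of FINTYPE's relative clause, vs `satakePolynomial` in SART; `ψ_η` = the `ℓ`-adic avatar of the L-algebraic Hecke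
character `η`: Weil 1956 / Serre 1968, rank-one (A)) is semisimple and Satake–Frobenius compatible with `π` at a.e. `v` — EXACTLY, not up to `μ_f`.

## Pieces (FINTYPE ⟸ TSF ∧ SART ∧ RSR ∧ FRAC; kernel `closes_target`, 0 sorry)

* **TSF** `TwistedShadowFiniteImage` [new] (support · PRINT/FOLKLORE · Galois side; NOT S-implied, honest EXCESS like g26's TP): FINTYPE's hypotheses
  VERBATIM + the dial `TwistGaloisType` ⟹ some finite `M/K` along which `π ⊗ η⁻¹` is of pure Galois type.  Proof in print-grade pieces: the avatar
  `ψ_η` of `η` (rank-one (A)); `r' := r ⊗ ψ_η|_L⁻¹` is semisimple with root-of-unity Frobenius eigenvalues a.e. (dial + relative avatar); Chebotarev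
  density + continuity of `charpoly` ⟹ every element of `r'(Γ_L)` has spectrum in `μ_N` (bounded `N`: eigenvalues live in extensions of a fixed
  `ℓ`-adic field `E` of degree `≤ n`); BURNSIDE's trace theorem (an absolutely irreducible linear group in characteristic 0 with finitely many traces is
  finite, `|G| ≤ m^{d²}`; Burnside 1905, Curtis–Reiner (1962) §36) on each constituent of the semisimple `r'` ⟹ `r'` has FINITE IMAGE (equivalently: the
  Zariski closure of `r'(Γ_L)` is reductive with unipotent identity component, hence finite); `M` := Galois closure over `K` of the fixed field of `ker r'`
  (then `Frob_u = Frob_w^{f(u|w)} ∈ ker r'` gives `(a/b)^{f(u|v)} = 1`).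
* **SART** = tree `MonomialConverse.StrongArtinAE` (stmt-Langlands-18578, the registered TARGET of route-Langlands-MonomialConverse; OPEN; crux rank 2 here):
  strong Artin in the a.e. form, all `F`, all `n ≥ 2`.  LATERAL: it is the (B)-direction on Artin representations (S-implied in print; the kernel
  certificate `Langlands → StrongArtinAE` needs the `ι`-dictionary finite-image `ℚ̄_ℓ` ↔ `ℂ` and «finite image ⇒ de Rham», neither in the tree —
  typing debt, not mathematics).  BARRIER-side: NonRegularWeight (Artin weight `(0,…,0)`), SolvableImageBarrier for the insoluble hull groups;
  print islands: nilpotent/accessible-solvable image (Arthur–Clozel III.7), odd icosahedral over `ℚ`/TR (Kisin, KW, Pilloni–Stroh, Sasaki) and its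
  `Sym²` / `⊗` / `Sym⁴` shadows (Gelbart–Jacquet, Ramakrishnan, Kim) = ALL irreducibles of an ODD `A₅`-extension of `ℚ`.
* **RSR** `RegularShadowRigidity` [new] (crux rank 3 · ATTACKABLE-NOW: the paper proof above is complete; S-implied in the kernel via `W⁺`,
  `rsr_of_satakeAvatar` / `rsr_of_langlands`): pure Galois type along `M` up to an L-algebraic `GL₁`-twist + strong Artin over `K` ⟹ a semisimple avatar.
  LAYER-FREE (no `L`, no `r`): the relative avatar is consumed by TSF, the automorphic input by RSR — the cut separates Galois side from automorphic side.
* **FRAC** `FractionalTypeShadowDescent` [new][conjecture: EMPTY] (declared COMPLEMENT, UNDECIDED-with-test): FINTYPE's text VERBATIM with `¬ TwistGaloisType`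
  inserted — finite Satake-RATIO type but NOT Galois type up to any L-algebraic Hecke twist.  MEANING: by TSF's argument `r|_{Γ_{L₁}} = n·χ₁` on a
  finite layer `L₁` with `χ₁ⁿ = Ψ_{ω_π}|_{L₁}`; the cell is non-empty only if the infinity type of `ω_π` is NOT divisible by `n` although all Satake
  ratios are torsion («fractional-weight shadow»; conjecturally impossible: avatars are Hodge–Tate).  TEST (print, `GL₂/ℚ`): empty — holomorphic
  weight `k ≥ 2` non-CM forms have equidistributed Satake angles (Sato–Tate, BLGHT 2011) so torsion ratios have density 0; CM forms of weight `≥ 2`: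
  `χ(𝔭)/χ(𝔭̄)` generates the ideal `(𝔭/𝔭̄)^{k−1} ≠ 1`, not a root of unity; weight one and `λ = ¼` have `ω_π` of finite order · `|·|⁰`.  First open
  instance: `GL₂` over an imaginary quadratic field / `GL₃/ℚ`.  Twist-SATURATED by construction (the dial quantifies over all L-algebraic `η`).

EXTREMAL READING.  A minimal counterexample `π` to FINTYPE is, after TSF, a cuspidal `π'` of pure Galois type along a finite Galois `M/K` that is
NOT `π_A` for any `A ∈ Irr Gal(M/K)`; RSR says such a `π'` forces `∏_A L(s,π'×π̃_A)^{dim A}` to be pole-free at `1` while equal to `ζ_M(s)ⁿ` —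
so the counterexample must come with an irreducible `A₀` of `Gal(M/K)` VIOLATING strong Artin: the finite-type cell of non-solvable descent
contains no open problem beyond strong Artin for its own splitting groups (and the fractional-weight monster FRAC).

KERNEL (0 sorry): `closes_target : TSF → StrongArtinAE → RSR → FRAC → FINTYPE` BY NAME (`by_cases` on the dial; the `∃ M` of TSF is threaded
into RSR, SART specialised to `K`); `frac_of_finiteType` (FRAC ⟸ FINTYPE, one inserted hypothesis); `finiteType_of_perfect`/`_of_langlands`,
`frac_of_langlands`, `rsr_of_satakeAvatar : PrimeSwitchSplit.SatakeAvatarExistence → RSR` (W⁺ = stmt-Langlands-17415), `rsr_of_langlands`;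
host edge `closes_route : EXT → RIGID → TSF → StrongArtinAE → RSR → FRAC → RED° → GaloisHullLift.PerfectHullDescent` via the route's own `closes`;
and the decided algebraic heart `regular_collapse : IsPrimitiveRoot ζ f → t ^ f = 1 → ∏_{i<f} (X − C (ζ^i·t)) = X ^ f − 1` (+ `_complex`, `_multi`:
the local Euler-factor collapse `∏ⱼ∏_{ζ∈μ_f}(X − C(ζ tⱼ)) = (X^f − 1)ⁿ`).

HONEST FLAGS. (1) One-way: FINTYPE ⟹ FRAC is proved, FINTYPE ⟹ RSR / SART is not claimed (RSR is layer-free, SART is the (B)-side) — laterals, as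
RIGID in g26 and PAR in g30. (2) TSF is print/folklore but NOT S-implied as typed (Burnside is not reciprocity) — excess support, declared. (3) SART is
cited BY NAME from another route (DAG edge PerfectLayerClifford:27356 ⟵ MonomialConverse:18578); its kernel S-certificate is typing debt (ι-dictionary).
(4) No perfectness, no reducibility and no `[L:K] ≠ 1` is used in the paper proofs of TSF/RSR: the same mechanism decides finite-type descent along ANY
Galois layer — in particular the finite-type sectors of EXT ∧ RIGID (r irreducible); FINTYPE is the registered target, so TSF/FRAC carry its hypotheses verbatim.

NEAREST PRIOR ART (searched: corpus fts+vec, galaxy).  Arthur–Clozel close AMS 120 with the «tantalizing remark» [corpus: arthur1989 p.191]: for the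
regular representation `r = ⊕ deg(ρ)·ρ` of a SOLVABLE `Γ` the isobaric `π` with `L(s,π) = ζ_E(s)` exists by base change, and comparing the poles of
`L(s,π⊗π)` and `L(s,r⊗r)` at `s = 1` gives `Σ dᵢ² = Σ deg(ρ)² = n` — «showing that each `ρ` is associated to a cuspidal `πᵢ`, however, seems to be
difficult».  RSR runs the same pole count in the OPPOSITE direction: not to construct the `π_ρ` but, GIVEN them (strong Artin for `Γ`), to RECOGNISE an
arbitrary cuspidal `π'` of pure Galois type along `M` as one of them — which is what dissolves the `μ_f`-ambiguity of FINTYPE's relative avatar.  The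
pole-order comparisons of AC Prop. 6.x/7.2 [corpus: arthur1989 pp.180,186] and Getz's nonsolvable base-change/descent programme [corpus: getz2024 p.275,
[Get12]] are the other neighbours; none treats the finite-Satake-ratio cell of a reducible relative avatar.

Sources: H. Jacquet, J. Shalika, On Euler products and the classification of automorphic representations I/II, Amer. J. Math. 103 (1981) 499–558 /
777–815 (bib JacquetShalika1981); F. Shahidi, On certain L-functions, Amer. J. Math. 103 (1981) 297–355, Thm 5.2; H. Jacquet, I. Piatetski-Shapiro,
J. Shalika, Rankin–Selberg convolutions, Amer. J. Math. 105 (1983) 367–464; J. Arthur, L. Clozel, Simple algebras, base change, and the advanced theory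
of the trace formula, Ann. Math. Stud. 120 (1989) Ch. 3 §§6–7 (bib ArthurClozelAMS120); W. Burnside, Proc. LMS (2) 3 (1905) 435–440 / C. Curtis,
I. Reiner, Representation theory of finite groups and associative algebras (1962) §36; A. Weil, On a certain type of characters of the idèle-class
group of an algebraic number-field (1956) / J.-P. Serre, Abelian ℓ-adic representations and elliptic curves (1968) Ch. II–III; T. Barnet-Lamb,
D. Geraghty, M. Harris, R. Taylor, A family of Calabi–Yau varieties and potential automorphy II, Publ. RIMS 47 (2011) (Sato–Tate); the tree:
`PerfectLayerClifford.closes`, `TatePhantomLift.perfect_of_langlands`, `MonomialConverse.StrongArtinAE`, `PrimeSwitchSplit.SatakeAvatarExistence`.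
-/

set_option linter.dupNamespace false
set_option linter.unusedVariables false
set_option linter.style.longLine false
set_option linter.unusedSectionVars false

namespace Summit.Langlands.Langlands.Theorems.RegularShadowSplit

open scoped BigOperators Topology Matrix Classical
open Filter Set Function
open Literature.NumberTheory.GaloisRepresentations Literature.NumberTheory.Automorphic
open IsDedekindDomain
open Summit.Langlands.Langlands.Theses
open scoped NumberField Polynomial

/-! ## §0 The dial, the purity predicate, strong Artin over one field -/

/-- [new] THE DIAL `TwistGaloisType K n hcpt π` («Galois type up to an L-algebraic `GL₁`-twist»): there is a cuspidal (= automorphic) L-algebraic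
`η` on `GL₁/K` such that, at almost every `v`, every Satake parameter of `π` is congruent to the Satake parameter of `η` modulo roots of unity.
Twist-saturated by construction. -/
def TwistGaloisType (K : Type) [Field K] [NumberField K] (n : ℕ)
    (hcpt : isCompact_glFiniteIntegralLevel n K) (π : CuspidalAutomorphicRepData n K hcpt) : Prop :=
  ∃ (hcpt₁ : isCompact_glFiniteIntegralLevel 1 K) (η : CuspidalAutomorphicRepData 1 K hcpt₁),
    η.1.IsLAlgebraic ∧ ∀ᶠ v : HeightOneSpectrum (𝓞 K) in cofinite, ∀ (α β : Multiset ℂ),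
      π.1.HasSatakeParamAt v α → η.1.HasSatakeParamAt v β → ∀ a ∈ α, ∀ b ∈ β, ∃ k : ℕ, 0 < k ∧ a ^ k = b ^ k

/-- [new] PURE GALOIS TYPE ALONG `M` UP TO THE TWIST `η`: for almost every finite place `u` of `M` (over `v` of `K`, residue degree `f(u|v)`),
every Satake parameter `a` of `π` at `v` and the parameter `b` of `η` at `v` satisfy `(a/b)^{f(u|v)} = 1`.  (For `M` the splitting field of an
Artin representation `A` and `π ⊗ η⁻¹ = π_A` this is `A(Frob_u) = 1`.) -/
def PureTypeAlong (K : Type) [Field K] [NumberField K] (n : ℕ)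
    (hcpt : isCompact_glFiniteIntegralLevel n K) (π : CuspidalAutomorphicRepData n K hcpt)
    (M : Type) [Field M] [NumberField M] [Algebra K M]
    (hcpt₁ : isCompact_glFiniteIntegralLevel 1 K) (η : CuspidalAutomorphicRepData 1 K hcpt₁) : Prop :=
  ∀ᶠ u : HeightOneSpectrum (𝓞 M) in cofinite, ∀ (v : HeightOneSpectrum (𝓞 K)) (α β : Multiset ℂ),
    u.asIdeal.under (𝓞 K) = v.asIdeal → π.1.HasSatakeParamAt v α → η.1.HasSatakeParamAt v β →
      ∀ a ∈ α, ∀ b ∈ β, (a * b⁻¹) ^ (u.asIdeal.inertiaDeg (𝓞 K)) = 1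

/-- [new] (≡ the body of the tree decl `MonomialConverse.StrongArtinAE`, stmt-Langlands-18578, at ONE field `K`) strong Artin over `K` in the a.e.
form, all degrees `m ≥ 2` (degree 1 is class field theory, tree `artinReciprocity_character_holds`). -/
def StrongArtinOver (K : Type) [Field K] [NumberField K] : Prop :=
  ∀ (m : ℕ), 2 ≤ m → ∀ A : FramedGaloisRep K ℂ m, A.toGaloisRep.IsIrreducible →
    ∃ (hcptA : isCompact_glFiniteIntegralLevel m K) (πA : CuspidalAutomorphicRepData m K hcptA),
      ∀ᶠ v : HeightOneSpectrum (𝓞 K) in cofinite, ∃ α : Multiset ℂ,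
        πA.1.HasSatakeParamAt v α ∧ A.IsUnramifiedAt v ∧ A.HasFrobCharpolyAt v (satakePolynomial α)

/-- `StrongArtinOver K` is `MonomialConverse.StrongArtinAE` (stmt-Langlands-18578) specialised to the base field `K` (definitional). -/
theorem strongArtinOver_of_strongArtinAE (h : MonomialConverse.StrongArtinAE) (K : Type) [Field K] [NumberField K] :
    StrongArtinOver K := fun m hm A hA => h K m hm A hA

/-! ## §1 The pieces (P1/P4 = FINTYPE's tree text `3924d1b21172` with ONE insertion each, generated by `gen_node32.py`; P3 lateral, layer-free) -/

/-- [new] **TSF** (support · PRINT/FOLKLORE: rank-one (A) for `η`, Chebotarev density, Burnside's trace theorem): FINTYPE's hypotheses verbatim, plus the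
dial, give a finite layer `M/K` along which `π` is of pure Galois type up to the twist.  NOT S-implied as typed (excess support, declared). -/
def TwistedShadowFiniteImage : Prop :=
  ∀ (K : Type) [Field K] [NumberField K] (n : ℕ) (hcpt : Literature.NumberTheory.Automorphic.isCompact_glFiniteIntegralLevel n K), 0 < n → ∀ (π : Literature.NumberTheory.Automorphic.CuspidalAutomorphicRepData n K hcpt), π.1.IsLAlgebraic → ∀ (L : Type) [Field L] [NumberField L] [Algebra K L], IsGalois K L → Module.finrank K L ≠ 1 → (¬ ∃ F : IntermediateField K L, F ≠ ⊥ ∧ IsGalois K ↥F ∧ IsCyclic (↥F ≃ₐ[K] ↥F) ∧ (Module.finrank K ↥F).Prime) → ∀ (ℓ : ℕ) [Fact ℓ.Prime] (ι : PadicAlgCl ℓ ≃+* ℂ) (r : Literature.NumberTheory.GaloisRepresentations.FramedGaloisRep L (PadicAlgCl ℓ) n), r.toGaloisRep.IsSemisimple → ¬ r.IsIrreducible → (∀ᶠ v : IsDedekindDomain.HeightOneSpectrum (NumberField.RingOfIntegers K) in cofinite, ∀ α : Multiset ℂ, π.1.HasSatakeParamAt v α → ∀ a ∈ α, ∀ b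 ∈ α, ∃ k : ℕ, 0 < k ∧ a ^ k = b ^ k) → (∀ᶠ w : IsDedekindDomain.HeightOneSpectrum (NumberField.RingOfIntegers L) in cofinite, ∀ (v : IsDedekindDomain.HeightOneSpectrum (NumberField.RingOfIntegers K)) (α : Multiset ℂ), w.asIdeal.under (NumberField.RingOfIntegers K) = v.asIdeal → π.1.HasSatakeParamAt v α → r.IsUnramifiedAt w ∧ r.HasFrobCharpolyAt w (Literature.NumberTheory.Automorphic.arithFrobPolyOfSatake ι w.residueCard 1 (α.map (fun a => a ^ w.asIdeal.inertiaDeg (NumberField.RingOfIntegers K))))) → TwistGaloisType K n hcpt π → ∃ (M : Type) (instF : Field M) (instN : NumberField M) (instA : Algebra K M) (hcpt₁ : Literature.NumberTheory.Automorphic.isCompact_glFiniteIntegralLevel 1 K) (η : Literature.NumberTheory.Automorphic.CuspidalAutomorphicRepData 1 K hcpt₁), η.1.IsLAlgebraic ∧ PureTypeAlong K n hcpt π M hcpt₁ η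

/-- [new] **RSR** (crux · rank 3 · ATTACKABLE-NOW; S-implied: `rsr_of_satakeAvatar`): THE REGULAR-REPRESENTATION RIGIDITY.  Pure Galois type along a
finite `M/K` up to an L-algebraic `GL₁`-twist, plus strong Artin over `K`, yield a semisimple `ℓ`-adic avatar of `π` — Satake-compatible EXACTLY
(`∏_A L^S(s,π'×π̃_A)^{dim A} = ζ_M^S(s)ⁿ`; JS poles + Shahidi non-vanishing; see the module docstring). -/
def RegularShadowRigidity : Prop :=
  ∀ (K : Type) [Field K] [NumberField K] (n : ℕ) (hcpt : Literature.NumberTheory.Automorphic.isCompact_glFiniteIntegralLevel n K), 0 < n → ∀ (π : Literature.NumberTheory.Automorphic.CuspidalAutomorphicRepData n K hcpt), π.1.IsLAlgebraic → ∀ (ℓ : ℕ) [Fact ℓ.Prime] (ι : PadicAlgCl ℓ ≃+* ℂ) (M : Type) [Field M] [NumberField M] [Algebra K M] (hcpt₁ : Literature.NumberTheory.Automorphic.isCompact_glFiniteIntegralLevel 1 K) (η : Literature.NumberTheory.Automorphic.CuspidalAutomorphicRepData 1 K hcpt₁), η.1.IsLAlgebraic → StrongArtinOver K → PureTypeAlong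 K n hcpt π M hcpt₁ η → ∃ ρ : Literature.NumberTheory.GaloisRepresentations.FramedGaloisRep K (PadicAlgCl ℓ) n, ρ.toGaloisRep.IsSemisimple ∧ ∀ᶠ v : IsDedekindDomain.HeightOneSpectrum (NumberField.RingOfIntegers K) in cofinite, SatakeFrobCompatibleAt ι π.1 ρ v

/-- [new][conjecture: the cell is EMPTY] **FRAC** (declared complement · UNDECIDED, test = divisibility of the infinity type of `ω_π` by `n` under
finite ratio type; `GL₂/ℚ`: empty in print): FINTYPE's text with `¬ TwistGaloisType` inserted — the fractional-weight shadow. -/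
def FractionalTypeShadowDescent : Prop :=
  ∀ (K : Type) [Field K] [NumberField K] (n : ℕ) (hcpt : Literature.NumberTheory.Automorphic.isCompact_glFiniteIntegralLevel n K), 0 < n → ∀ (π : Literature.NumberTheory.Automorphic.CuspidalAutomorphicRepData n K hcpt), π.1.IsLAlgebraic → ¬ TwistGaloisType K n hcpt π → ∀ (L : Type) [Field L] [NumberField L] [Algebra K L], IsGalois K L → Module.finrank K L ≠ 1 → (¬ ∃ F : IntermediateField K L, F ≠ ⊥ ∧ IsGalois K ↥F ∧ IsCyclic (↥F ≃ₐ[K] ↥F) ∧ (Module.finrank K ↥F).Prime) → ∀ (ℓ : ℕ) [Fact ℓ.Prime] (ι : PadicAlgCl ℓ ≃+* ℂ) (r : Literature.NumberTheory.GaloisRepresentations.FramedGaloisRep L (PadicAlgCl ℓ) n), r.toGaloisRep.IsSemisimple → ¬ r.IsIrreducible → (∀ᶠ v : IsDedekindDomain.HeightOneSpectrum (NumberField.RingOfIntegers K) in cofinite, ∀ α : Multiset ℂ, π.1.HasSatakeParamAt v α → ∀ a ∈ α, ∀ b ∈ α, ∃ k : ℕ, 0 < k ∧ a ^ k = b ^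 k) → (∀ᶠ w : IsDedekindDomain.HeightOneSpectrum (NumberField.RingOfIntegers L) in cofinite, ∀ (v : IsDedekindDomain.HeightOneSpectrum (NumberField.RingOfIntegers K)) (α : Multiset ℂ), w.asIdeal.under (NumberField.RingOfIntegers K) = v.asIdeal → π.1.HasSatakeParamAt v α → r.IsUnramifiedAt w ∧ r.HasFrobCharpolyAt w (Literature.NumberTheory.Automorphic.arithFrobPolyOfSatake ι w.residueCard 1 (α.map (fun a => a ^ w.asIdeal.inertiaDeg (NumberField.RingOfIntegers K))))) → ∃ ρ : Literature.NumberTheory.GaloisRepresentations.FramedGaloisRep K (PadicAlgCl ℓ) n, ρ.toGaloisRep.IsSemisimple ∧ ∀ᶠ v : IsDedekindDomain.HeightOneSpectrum (NumberField.RingOfIntegers K) in cofinite, SatakeFrobCompatibleAt ι π.1 ρ v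

/-! ## §2 Kernel: `closes_target` BY NAME, the target-side and summit-side edges -/

/-- **The deciding theorem** (0 sorry): TSF → SART → RSR → FRAC → FINTYPE, concluding the tree decl BY NAME. -/
theorem closes_target (hT : TwistedShadowFiniteImage) (hA : MonomialConverse.StrongArtinAE)
    (hR : RegularShadowRigidity) (hF : FractionalTypeShadowDescent) :
    PerfectLayerClifford.FiniteTypePerfectDescent := by
  intro K _ _ n hcpt hn π hπ L _ _ _ hGal h1 hnc ℓ _ ι r hr hnirr hfin hrel
  by_cases hDT : TwistGaloisType K n hcpt π
  · obtain ⟨M, instF, instN, instA, hcpt₁, η, hη, hpure⟩ :=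
      hT K n hcpt hn π hπ L hGal h1 hnc ℓ ι r hr hnirr hfin hrel hDT
    exact hR K n hcpt hn π hπ ℓ ι M hcpt₁ η hη (strongArtinOver_of_strongArtinAE hA K) hpure
  · exact hF K n hcpt hn π hπ hDT L hGal h1 hnc ℓ ι r hr hnirr hfin hrel

/-- FRAC is WEAKER than FINTYPE (one inserted hypothesis). -/
theorem frac_of_finiteType (h : PerfectLayerClifford.FiniteTypePerfectDescent) : FractionalTypeShadowDescent := by
  intro K _ _ n hcpt hn π hπ hDT L _ _ _ hGal h1 hnc ℓ _ ι r hr hnirr hfin hrel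
  exact h K n hcpt hn π hπ L hGal h1 hnc ℓ ι r hr hnirr hfin hrel

/-- FINTYPE is WEAKER than the host crux RPERF (two inserted hypotheses); `private` at the critic's request (row 432: the audit reads a
public `RPERF → FINTYPE` as a proof-of-item on 27356; the twin is strictly `--supports`). -/
private theorem finiteType_of_perfect (hP : GaloisHullLift.PerfectHullDescent) : PerfectLayerClifford.FiniteTypePerfectDescent := by
  intro K _ _ n hcpt hn π hπ L _ _ _ hGal h1 hnc ℓ _ ι r hr hnirr hfin hrel
  exact hP K n hcpt hn π hπ L hGal h1 hnc ℓ ι r hr hrel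

/-- FINTYPE is S-implied; `private`: the junction direction S ⟹ item is recorded in the kernel for the necessity certificates
below but not exported (census twin hygiene G39 (a), p826755 precedent). -/
private theorem finiteType_of_langlands (hL : _root_.Langlands) : PerfectLayerClifford.FiniteTypePerfectDescent :=
  finiteType_of_perfect (TatePhantomLift.perfect_of_langlands hL)

/-- FRAC is S-implied. -/
theorem frac_of_langlands (hL : _root_.Langlands) : FractionalTypeShadowDescent :=
  frac_of_finiteType (finiteType_of_langlands hL)

/-- RSR is WEAKER than `W⁺` = `PrimeSwitchSplit.SatakeAvatarExistence` (stmt-Langlands-17415): its conclusion is avatar existence. -/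
theorem rsr_of_satakeAvatar (hW : PrimeSwitchSplit.SatakeAvatarExistence) : RegularShadowRigidity := by
  intro K _ _ n hcpt hn π hπ ℓ _ ι M _ _ _ hcpt₁ η hη hSA hpure
  obtain ⟨ρ, hirr, hc⟩ := hW K n hcpt hn π hπ ℓ ι
  have hss : ρ.toGaloisRep.IsSemisimple := by
    haveI : ρ.toGaloisRep.toRepresentation.IsIrreducible := hirr
    change ComplementedLattice _
    infer_instance
  exact ⟨ρ, hss, hc⟩

/-- RSR is S-implied (the summit's `ρ_{π,ι}` is irreducible, hence semisimple, and compatible a.e.). -/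
theorem rsr_of_langlands (hL : _root_.Langlands) : RegularShadowRigidity := by
  intro K _ _ n hcpt hn π hπ ℓ _ ι M _ _ _ hcpt₁ η hη hSA hpure
  obtain ⟨⟨Rec⟩, h⟩ := hL K
  obtain ⟨ρ, hirr, -, hcorr, -⟩ := (h Rec n hn hcpt).1 π hπ ℓ ι
  have hss : ρ.toGaloisRep.IsSemisimple := by
    haveI : ρ.toGaloisRep.toRepresentation.IsIrreducible := hirr
    change ComplementedLattice _
    infer_instance
  exact ⟨ρ, hss, hcorr.1⟩

/-! ## §3 Host edges -/

/-- The item edge in the shape a `--split FiniteTypePerfectDescent --into …` glue would take (curried, conclusion BY NAME). -/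
theorem closes_item : TwistedShadowFiniteImage → MonomialConverse.StrongArtinAE → RegularShadowRigidity → FractionalTypeShadowDescent →
    PerfectLayerClifford.FiniteTypePerfectDescent := closes_target

/-- Host edge: the four pieces replace FINTYPE in the route's own deciding theorem `PerfectLayerClifford.closes`. -/
theorem closes_route (hE : PerfectLayerClifford.PerfectLayerExtension) (hRg : PerfectLayerClifford.PerfectLayerRigidity)
    (hT : TwistedShadowFiniteImage) (hA : MonomialConverse.StrongArtinAE) (hR : RegularShadowRigidity) (hF : FractionalTypeShadowDescent)
    (hD : PerfectLayerClifford.ReduciblePerfectDescent) : GaloisHullLift.PerfectHullDescent :=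
  PerfectLayerClifford.closes hE hRg (closes_target hT hA hR hF) hD

/-! ## §4 The decided algebraic heart: the local Euler-factor collapse -/

section Collapse
open Polynomial

/-- **Regular collapse** (kernel-certified; the identity behind RSR's `∏_A L_v(s,π'×π̃_A)^{dim A} = ζ_{M,v}(s)ⁿ`): if `t ^ f = 1` and `ζ` is a primitive
`f`-th root of unity then the `f` numbers `ζ^i · t` — the eigenvalues of `t · R(γ)`, `R` the regular representation of a cyclic group `⟨γ⟩` of
order `f` — have characteristic polynomial `X ^ f − 1`: the parameter `t` has DISAPPEARED.  (Mathlib's Kummer factorisation `X_pow_sub_C_eq_prod`.) -/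
theorem regular_collapse {R : Type*} [CommRing R] [IsDomain R] {f : ℕ} (hf : 0 < f) {ζ t : R}
    (hζ : IsPrimitiveRoot ζ f) (ht : t ^ f = 1) :
    ∏ i ∈ Finset.range f, (X - C (ζ ^ i * t)) = X ^ f - 1 := by
  rw [← X_pow_sub_C_eq_prod hζ hf ht, C_1]

/-- The same over `ℂ` with `ζ = exp(2πi/f)` (Satake parameters are complex numbers). -/
theorem regular_collapse_complex {f : ℕ} (hf : 0 < f) {t : ℂ} (ht : t ^ f = 1) :
    ∏ i ∈ Finset.range f, (X - C (Complex.exp (2 * Real.pi * Complex.I / f) ^ i * t)) = X ^ f - 1 :=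
  regular_collapse hf (Complex.isPrimitiveRoot_exp f hf.ne') ht

/-- … and for a whole Satake multiset of pure Galois type (`tⱼ ^ f = 1` for all `j`): the `n·f` twisted parameters have characteristic polynomial
`(X ^ f − 1) ^ n`, i.e. `∏ⱼ ∏_{ζ ∈ μ_f} (1 − tⱼ ζ q⁻ˢ) = (1 − q^{−f s})ⁿ` after `X ↦ q^{s}`-reversal — the local identity RSR multiplies over `v`
(each of the `|Γ|/f` places `u ∣ v` of `M` contributes `(1 − N(u)⁻ˢ)⁻ⁿ = (1 − q^{−f s})⁻ⁿ` to `ζ_M(s)ⁿ`). -/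
theorem regular_collapse_multi {f n : ℕ} (hf : 0 < f) (t : Fin n → ℂ) (ht : ∀ j, t j ^ f = 1) :
    ∏ j, ∏ i ∈ Finset.range f, (X - C (Complex.exp (2 * Real.pi * Complex.I / f) ^ i * t j)) = (X ^ f - 1) ^ n := by
  rw [Finset.prod_congr rfl (fun j _ => regular_collapse_complex hf (ht j)), Finset.prod_const, Finset.card_univ,
    Fintype.card_fin]

end Collapse

end Summit.Langlands.Langlands.Theorems.RegularShadowSplit
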